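import Summits.ResolutionOfSingularities.ResolutionOfSingularities.Theorems.HilbertSamuelEliminationCampaignW42ConeDictionary
import Literature.RingTheory.HilbertSamuel.HilbertFunctionBaseChange
import HarnessLib

/-!
# [OURS · L1 W4.2] Ridge confinement at NON-rational closed points of a cone (Hironaka's phenomenon in
# positive characteristic included): a closed point of the cone near to the vertex lies in the ridge
# (campaign s42, cell res-hironaka; informal crux `RidgeConfinement`, stmt-ResolutionOfSingularities-17845;
# `--supports`)

HONEST FRAMING. OURS (slot W4.2, prover res-L1-s42-pv-1, gen 2): the assembly of parts I–III
(`…ConeFrame`, `…ConeBaseChange`, `…ConeDictionary`). For a homogeneous ideal `I ⊆ K[X_1..X_n]` (any field `K`,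
any characteristic), `T = K[X]/I` presented by `π : K[X] ↠ T`, and a CLOSED point `𝔮 ⊇ I` of the cone
`C = V(I)` with residue field `κ = K[X]/𝔮` presented by `ρ : T ↠ κ` (an arbitrary finite extension of `K`,
separable or not):

* **`frame_point_mem_ridge_of_iterPSum_le`** — if `𝔮` is NEAR to the vertex, in the precise sense
  `H(S/I)⁽ⁿ⁺¹⁾ ≤ H⁽ⁿ⁺¹⁾(𝒪_{C,𝔮})` (the reverse inequality always holds: semicontinuity), then the tautological
  point `w = (X_i mod 𝔮)_i ∈ C(κ)` lies in Giraud's ridge `F(C)(κ)`;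
* **`ridgeIdeal_le_of_iterPSum_le`** — equivalently `𝔉 ⊆ 𝔮` for the ideal `𝔉 = ridgeIdeal I` of the ridge:
  **the closed point `𝔮` lies on the ridge `V(𝔉)`** (CJS Thm. 3.14 for closed points, WITHOUT the
  perfectness / characteristic hypothesis, with the ridge in place of the directrix — Hironaka's theorem that
  near points are confined to the ridge; cf. CJS Rem. 3.15 / Hironaka's example where the directrix fails);
* `ridgeIdeal_le_of_hilbertFun_le`, `ridgeIdeal_le_of_isMaximal` — the same from `H(S/I) ≤ H⁽⁰⁾(𝒪_{C,𝔮})`, and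
  the self-contained form with `T = K[X]/I`, `κ = K[X]/𝔮`.

Proof (Hironaka 1970 / CJS proof of Thm. 3.10–3.14, executed in the tree): with the frame
`L = (T[Z])_{(𝔮,Z)}`: `H(S/I)⁽ⁿ⁺¹⁾ ≤ H⁽ⁿ⁺¹⁾(𝒪_{C,𝔮}) = H⁽¹⁾(L)` (flat point extension, part I)
`≤ Σ_i Φ⁽ⁿ⁾(i) ℓ_L(L/(θ(𝔮) + (Z)^{m+1-i})L)` (Hironaka's base-change bound through the twisted embedding
`K[X]_𝔮 → L`, part II) `= (H⁽¹⁾(𝒪_{C_κ,w}))⁽ⁿ⁾` (dictionary, part III) `≤ (H⁽¹⁾(𝒪_{C_κ,0}))⁽ⁿ⁾ = H(S/I)⁽ⁿ⁺¹⁾`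
(semicontinuity on `C_κ` and base-change invariance of `H(S/I)`); so equality holds throughout, `w` is near on
`C_κ`, hence `w ∈ F(C)(κ)` by the rational case over `κ` (`…RidgeConeNear`).

NOTHING here is a statement of H. Hironaka's manuscript [Hironaka2017]. AI review is weaker than expert review.
References (orientation only): V. Cossart, U. Jannsen, S. Saito, LNM 2270 (2020), Thm. 3.10, Def. 3.13,
Thm. 3.14, Rem. 3.15; H. Hironaka, Ann. of Math. 92 (1970); J. Giraud, Ann. Sci. ÉNS 8 (1975) §1.5.
-/

noncomputable section

-- single-conjunct summit: the doubled namespace component `ResolutionOfSingularities` is mandated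
set_option linter.dupNamespace false

open MvPolynomial Module IsLocalRing
open Literature.RingTheory.HilbertSamuel
open Literature.AlgebraicGeometry.Resolution

namespace Summit.ResolutionOfSingularities.ResolutionOfSingularities.Theorems

namespace CampaignW42

universe u

variable {K : Type u} [Field K] {n : ℕ}

/-- `Σ_{i ≤ m} Φ⁽ʳ⁾(i) ν(m - i) = ν⁽ʳ⁾(m)` (the tree's `sum_mul_iterPSum_Phi`, reflected). [folklore] -/
theorem sum_iterPSum_Phi_mul_eq (r : ℕ) (ν : ℕ → ℕ) (m : ℕ) :
    ∑ i ∈ Finset.range (m + 1), iterPSum r Phi i * ν (m - i) = iterPSum r ν m := by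
  calc ∑ i ∈ Finset.range (m + 1), iterPSum r Phi i * ν (m - i)
      = ∑ i ∈ Finset.range (m + 1), (fun j => ν j * iterPSum r Phi (m - j)) (m + 1 - 1 - i) := by
        refine Finset.sum_congr rfl fun i hi => ?_
        have hi' : i ≤ m := Nat.lt_succ_iff.mp (Finset.mem_range.mp hi)
        simp only [Nat.add_sub_cancel, Nat.sub_sub_self hi', mul_comm]
    _ = ∑ j ∈ Finset.range (m + 1), ν j * iterPSum r Phi (m - j) :=
        Finset.sum_range_reflect (fun j => ν j * iterPSum r Phi (m - j)) (m + 1)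
    _ = iterPSum r ν m := sum_mul_iterPSum_Phi r ν m

section Assembly

variable {T : Type u} [CommRing T] [IsNoetherianRing T] (π : MvPolynomial (Fin n) K →+* T)
  {κ : Type u} [Field κ] [Algebra K κ] (ρ : T →+* κ)
  {I 𝔮 : Ideal (MvPolynomial (Fin n) K)} (hI : IsHomogeneousIdeal I) [𝔮.IsMaximal]
  (hπ : Function.Surjective π) (hkerπ : RingHom.ker π = I)
  (hρ : Function.Surjective ρ) (hkerρ : RingHom.ker (ρ.comp π) = 𝔮)
  (hρC : ∀ c : K, ρ (π (C c)) = algebraMap K κ c)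
  [(𝔮.map π).IsMaximal]
  [((𝔮.map π).map (C : T →+* MvPolynomial (Fin n) T) ⊔ idealOfVars (Fin n) T).IsMaximal]

include hI hπ hkerπ hρ hkerρ hρC in
/-- **A closed point of the cone near to the vertex gives a `κ`-point of the ridge** (`κ` its residue field):
if `H(S/I)⁽ⁿ⁺¹⁾ ≤ H⁽ⁿ⁺¹⁾(𝒪_{C,𝔮})`, then `w = (X_i mod 𝔮)_i ∈ F(C)(κ)`. Hironaka's argument: flat point
extension, base-change bound, dictionary, semicontinuity on `C_κ`. [cite: CossartJannsenSaito2020, Thm. 3.14] -/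
theorem frame_point_mem_ridge_of_iterPSum_le
    (h : iterPSum (n + 1) (hilbertFunQuot K n I) ≤ hilbertSamuelFun (Localization.AtPrime (𝔮.map π)) (n + 1)) :
    (fun i => ρ (π (X i))) ∈ ridge κ I := by
  set w : Fin n → κ := fun i => ρ (π (X i)) with hw
  have hI' : IsHomogeneousIdeal (coneIdeal κ I) := isHomogeneousIdeal_map (algebraMap K κ) hI
  have hker𝔮 : RingHom.ker π ≤ 𝔮 := fun x hx => by
    rw [← hkerρ, RingHom.mem_ker, RingHom.comp_apply, RingHom.mem_ker.mp hx, map_zero]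
  set Nw : ℕ → ℕ := fun d =>
    finrank κ (MvPolynomial (Fin n) κ ⧸ (coneIdeal κ I ⊔ RingHom.ker (eval w) ^ (d + 1))) with hNw
  set N₀ : ℕ → ℕ := fun d =>
    finrank κ (MvPolynomial (Fin n) κ ⧸ (coneIdeal κ I ⊔ idealOfVars (Fin n) κ ^ (d + 1))) with hN₀
  -- semicontinuity on `C_κ`
  have hle₁ : Nw ≤ N₀ := fun d => finrank_quotient_sup_ker_eval_pow_le hI' w d
  -- base-change invariance of the vertex numbers
  have hN₀eq : N₀ = psum (hilbertFunQuot K n I) := by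
    funext d
    rw [hN₀, ← hilbertFunQuot_map (algebraMap K κ) hI]
    exact finrank_quotient_sup_pow_eq_psum_hilbertFunQuot hI' d
  -- Hironaka's chain
  have hle₂ : iterPSum n N₀ ≤ iterPSum n Nw := by
    intro m
    have h1 : iterPSum n N₀ m ≤ hilbertSamuelFun (Localization.AtPrime
        ((𝔮.map π).map (C : T →+* MvPolynomial (Fin n) T) ⊔ idealOfVars (Fin n) T)) 1 m := by
      rw [hilbertSamuelFun, iterPSum_one, hilbertFun_localization_frame_eq (𝔮.map π),
        ← hilbertSamuelFun_succ, hN₀eq, ← iterPSum_succ']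
      exact h m
    have h2 : (hilbertSamuelFun (Localization.AtPrime
        ((𝔮.map π).map (C : T →+* MvPolynomial (Fin n) T) ⊔ idealOfVars (Fin n) T)) 1 m : ℕ∞) ≤
        (iterPSum n Nw m : ℕ) := by
      rw [hilbertSamuelFun_one_eq_length]
      refine (length_quotient_pow_frame_le_sum π 𝔮 _ hπ hker𝔮 m).trans (le_of_eq ?_)
      rw [← sum_iterPSum_Phi_mul_eq n Nw m, Nat.cast_sum]
      refine Finset.sum_congr rfl fun i hi => ?_
      have hi' : i ≤ m := Nat.lt_succ_iff.mp (Finset.mem_range.mp hi)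
      rw [Nat.cast_mul, show m + 1 - i = m - i + 1 by omega,
        length_quotient_frame_eq_finrank π ρ hπ hkerπ hρ hkerρ hρC _ (m - i)]
    exact h1.trans (by exact_mod_cast h2)
  have heq : Nw = N₀ :=
    iterPSum_injective n (le_antisymm (iterPSum_mono n hle₁) hle₂)
  exact mem_ridge_of_finrank_le_baseChange hI w fun d => (congr_fun heq d).ge

include hI hπ hkerπ hρ hkerρ hρC in
/-- **Ridge confinement at a closed point (CJS Thm. 3.14 for closed points, every characteristic, ridge in
place of directrix): a closed point `𝔮 ⊇ I` of the cone near to the vertex, `H(S/I)⁽ⁿ⁺¹⁾ ≤ H⁽ⁿ⁺¹⁾(𝒪_{C,𝔮})`,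
lies on the ridge: `𝔉 = ridgeIdeal I ⊆ 𝔮`.** [cite: CossartJannsenSaito2020, Thm. 3.14] -/
theorem ridgeIdeal_le_of_iterPSum_le
    (h : iterPSum (n + 1) (hilbertFunQuot K n I) ≤ hilbertSamuelFun (Localization.AtPrime (𝔮.map π)) (n + 1)) :
    ridgeIdeal I ≤ 𝔮 := by
  intro g hg
  have h0 := (mem_ridge_iff_forall_ridgeIdeal.mp
    (frame_point_mem_ridge_of_iterPSum_le π ρ hI hπ hkerπ hρ hkerρ hρC h)) g hg
  rw [aeval_frame_point_eq π ρ hρC g, ← RingHom.comp_apply, ← RingHom.mem_ker, hkerρ] at h0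
  exact h0

include hI hπ hkerπ hρ hkerρ hρC in
/-- The same from the Hilbert functions: **`H(S/I) ≤ H⁽⁰⁾(𝒪_{C,𝔮})` pointwise forces `ridgeIdeal I ⊆ 𝔮`.**
[cite: CossartJannsenSaito2020, Thm. 3.14] -/
theorem ridgeIdeal_le_of_hilbertFun_le
    (h : hilbertFunQuot K n I ≤ hilbertFun (Localization.AtPrime (𝔮.map π))) : ridgeIdeal I ≤ 𝔮 :=
  ridgeIdeal_le_of_iterPSum_le π ρ hI hπ hkerπ hρ hkerρ hρC (iterPSum_mono (n + 1) h)

end Assembly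

/-- **Ridge confinement at closed points of a cone, self-contained form.** For a homogeneous ideal `I` of
`S = K[X_1, …, X_n]` and a maximal ideal `𝔮 ⊇ I` (a closed point of the cone `C = V(I)`, with ANY residue
field): if `H(S/I)⁽ⁿ⁺¹⁾ ≤ H⁽ⁿ⁺¹⁾((S/I)_𝔮)` — `𝔮` is near to the vertex — then `ridgeIdeal I ⊆ 𝔮`, i.e. the
point lies on Giraud's ridge `V(𝔉) = F(C)`. [cite: CossartJannsenSaito2020, Thm. 3.14] -/
theorem ridgeIdeal_le_of_isMaximal {I 𝔮 : Ideal (MvPolynomial (Fin n) K)} (hI : IsHomogeneousIdeal I)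
    [𝔮.IsMaximal] (hI𝔮 : I ≤ 𝔮) [(𝔮.map (Ideal.Quotient.mk I)).IsMaximal]
    (h : iterPSum (n + 1) (hilbertFunQuot K n I) ≤
      hilbertSamuelFun (Localization.AtPrime (𝔮.map (Ideal.Quotient.mk I))) (n + 1)) :
    ridgeIdeal I ≤ 𝔮 := by
  letI := Ideal.Quotient.field 𝔮
  haveI := isMaximal_map_C_sup_idealOfVars (n := n) (𝔮.map (Ideal.Quotient.mk I))
  refine ridgeIdeal_le_of_iterPSum_le (Ideal.Quotient.mk I) (κ := MvPolynomial (Fin n) K ⧸ 𝔮)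
    (Ideal.Quotient.factor hI𝔮) hI Ideal.Quotient.mk_surjective Ideal.mk_ker
    (Ideal.Quotient.factor_surjective hI𝔮) ?_ (fun c => ?_) h
  · rw [Ideal.Quotient.factor_comp_mk, Ideal.mk_ker]
  · rw [Ideal.Quotient.factor_mk]
    rfl

end CampaignW42

end Summit.ResolutionOfSingularities.ResolutionOfSingularities.Theorems
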